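import Summits.AtomisticToContinuum.Crystallization.Theorems.ChartedZeroExcessLayeredLatticeLiouvilleTK

/-!
# Zero-excess layered lattice Liouville — part TL (lens-2 g37, node «LaunderAndUntwist» beneath (G♭) of part TJ, over part TK): the thin-regime pinning
estimate (G♭) `GradPinningThinP` splits along the structural dichotomy COHERENT DATUM (the registering map and the bond isomorphism index the
good sites of the window by the same layers of one TRUE-WORD chart — then only a LATERAL twist separates them) versus INCOHERENT DATUM (the datum
chart carries letters `S` does not have above its reach — GARBAGE — and must be LAUNDERED into a true-word chart first).  Structural facts found
this generation (instrument `layer_chain.py`, pure python, 10 s; memo `NODE-g37-LaunderAndUntwist.md`):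
(F5) VERTICAL TWIST = GARBAGE IN DISGUISE.  A bond isomorphism `Φ : S → H` and a registering map `Ψ : win R → H` into one equilibrium chart
`H = LayeredHom L w` may index a good site by DIFFERENT layers; re-anchoring `Φ` vertically re-imports the height/registry profile mismatch of (F2),
so an untwist statement allowing vertical re-indexing needs garbage detection again (bad cut), and demanding layer-compatibility at BAD sites makes
the laundering piece do the lateral untwist (bad cut the other way).  With the SAME-LAYER clause ON GOOD SITES (output profile `< 1/8`, the line's
misfit threshold) the residual twist is an in-plane lattice translation per good component, a GLOBAL SYMMETRY of `H` (`layeredHom_add_inplane`),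
under which the environment clause of `IsRegistered` is invariant for free (`envClose_of_sameLayer`, PROVED here); bad sites cost `144` each.
(F6) LABEL TRUTH IS GEOMETRIC.  A clean charted `S` is a boundaryless perfect Barlow crystal; between it and a clean `LayeredHom`, a bond isomorphism
transports labelled shells along good bonds exactly as the near-isometric registration does, so after ONE layer-preserving contact-graph automorphism
fixed at a good anchor, `Φ = Ψ` on the anchor's good component and `Φ = T_i ∘ Ψ` (in-plane lattice translations `T_i`) on the others; pairs (good site,
site within `4` in another component) are charged to a bad site within `1` of the joining segment (`≤ 629²` pairs per bad site) or are boundary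
orphans joined outside the ball, where the components' registered orientations agree modulo the chart's point group and a John-type `L^∞` rigidity of
clean boundaryless crystals (rotation oscillation `≤ C·θ < π/3` on balls) makes them agree outright.  No regime, no second scale: losses LINEAR in `κ·nK`.
(F7) LAUNDERING = LETTER TRUTH + CAP TRIANGLE + ONE-STEP TRANSPORT, a contraction in garbage-strength currency.  Charts ARE one-dimensional layer
chains (laterally homogeneous), `S` enters only through site weights.  (i) THIN ⇒ LETTERS TRUE IN REACH: a wrong letter `t` below the reach boundary of
a scale-`D` chart costs `≥ 0.381·D·t²` (three first-shell neighbours off by `d₀/√3`), the budget is `6.47·η·D³ < 6.47·c₀·D`, so only `t < 4.12·√c₀ < h*`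
is affordable (`c₀ ≤ 0.03`): every tested layer but the polar sliver carries `S`'s letter.  (ii) GARBAGE PROFILE of an equilibrium chain below a letter
change (Newton on the full LJ chain, `K₁ = 20.9`, `K_k ≈ −25.8·k⁻⁶`): spacing shifts `κ₀ ≈ κ₁ ≈ 3.1e-5` (registry defect `b₂ = 6.0e-4` over `K₁`),
`κ₂ ≈ 8e-7`, `κ₃ ≈ 1.3e-7`, then a POWER LAW `κ_j ∼ j⁻⁴`, height shifts `u_j ∼ j⁻³` (the displaced block above pulls layer `j` with force `∼ j⁻⁵` through
the class-independent `z⁻⁶` coupling tail) — NOT the geometric decay `0.054^j` of the truncated chain; `u₁ = 3.3e-5` saturates over all garbage words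
(a-priori bound).  (iii) CAP TRIANGLE: the polar sites of `win R` (population `6.1·j·R` at depth-layer `j`) see the profile; following a unit garbage
costs `c_f·R`, `c_f = 6.2–6.8e-9`; the scale-`(R+8)` chart has TRUE letters there (by (i)) and registers the same sites — they are INTERIOR to
`win (R+8)`, so a configuration following the datum's profile is charged at full cap weight by the next scale (no harmonic hiding) — hence
`P(R) ≤ 6·η·(nK(win R) + nK(win (R+8))) + 3·a₁²·P(R+8)` with `P(D) := q_D²·c_f·D` the cost of the scale-`D` chart's garbage on its own cap and
`a₁ = 1.0–3.4e-4` the amplitude its profile retains ten layers lower: ONE-STEP CONTRACTION `3·a₁² = 3.5e-7`, compounding geometrically (only `H′`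
enters the transfer, only `H″` bounds `q′`, …; summing all scales' influences directly would be the wrong, log-divergent bookkeeping); with the
a-priori bound the regress closes after `n ≈ log(c_f/(η·R²))/15` thin steps, UNIFORMLY in `η`: `C_Λ ≤ 84 (R = 10), 33 (R = 50), 26.3 (R → ∞)`.
(iv) TENSION RETUNE: the true-word chart is taken at the datum's stress (tame existence, F1 of part TJ) and compared to the datum letter by letter
(true in reach) — transfer `τ₁ ≤ τ′ + d`.  This resolves (F2)'s «cannot work as `η·R² → 0`»: the floor is paid by the next scale, not by the budget.
THE CUT: (G♭) ⟸ (Λ♭) `ThinLaunderingP` (laundering: a TRUE-WORD equilibrium chart on `L` registering `win R` at level `C_Λ·η` by SOME map that is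
layer-compatible ON ITS GOOD SITES with SOME bijective bond isomorphism `S → chart`; TRUE-expected · ATTACKABLE (steps (i)–(iv) + vertical
normalisation per registration-consistent cluster) · IDEA-NAMED · INSTRUMENTED) ∧ (Υ) `LateralUntwistP` (generic, single window, any level `κ ≤ κ₁`:
a pair (registering map, bond isomorphism) into one equilibrium chart, layer-compatible on the good sites, is untwisted into a bond isomorphism
registering at level `C_U·κ`; TRUE-type · ATTACKABLE (F5–F6)).  Glue PROVED (`gradPinningThinP_of_laundering_untwist`: `c₀` from (Λ♭), `C♭ := C_U·C_Λ`,
ceiling `min(η₁, κ₁/C_Λ)`, floor `max`); projection (G♭) ⇒ (Λ♭) PROVED; the free transfer of the environment clause under same-layer re-anchoring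
PROVED; (B2♭) ⟸ (G♯) ∧ (Λ♭) ∧ (Υ) at `aHi = 1` PROVED ((P) = `windowPoincareP_one`, hand-1 g17); columns `_16XH14` / `_16XH14W` (20 leaves: (Λ♭), (Υ)
replace (G♭) in `_16XH13` / `_16XH13W` of part TK).  Imports part TK (hand-1 g17) ⊇ WindowPoincare ⊇ part TJ.
0 EQUIV; placeholder-free; no type-class declarations, custom syntax or option pragmas.
-/

noncomputable section

open scoped BigOperators InnerProductSpace RealInnerProductSpace
open MeasureTheory Set Metric Filter Topology
open Summit.AtomisticToContinuum.Crystallization.Theorems.ChartedPlanarOrderRigidityDoor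
  (E3 IsClean IsNash IsCharted IsEStarGSC VisibleGap PertRegime atomsIn siteEnergy eStar BindingSurface)
open Summit.AtomisticToContinuum.Crystallization.Theorems.ChartedPlanarOrderDensityDichotomy (μS IsSep nK nK_nonneg excess)
open Summit.AtomisticToContinuum.Crystallization.Theorems.ChartedPlanarOrderMesoCut (IsDoorSet NearHom LayeredHom layerOf EnvClose)
open Summit.AtomisticToContinuum.Crystallization.Theorems.ChartedPlanarOrderDoorLayered
  (TwoPeriodic DoorPeriodic PeriodicBulkGapDoor NearHomL2BD Layered atomsIn_subset)
open Summit.AtomisticToContinuum.Crystallization.Theorems.ChartedPlanarOrderDoorLayeredOsc (IsTwoShellAffineGood DoorPeriodicOsc)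
open Summit.AtomisticToContinuum.Crystallization.Theorems.ChartedPlanarOrderCleanScaleP
  (IsCleanP IsDoorSetP DoorPeriodicP isDoorSetP_one_iff isCleanP_one_iff isCleanP_μS_iff)
open Literature.MathematicalPhysics.StatisticalMechanics (lennardJones IsHaggSeq triangularVec₁ triangularVec₂)
open Literature.Geometry.DiscreteGeometry (IsTwoShellGoodSet)

namespace Summit.AtomisticToContinuum.Crystallization.Theorems.ChartedZeroExcessLayeredLatticeLiouville

/-! ## §XIII  (lens-2 g37, node «LaunderAndUntwist» beneath (G♭)): (G♭) ⟸ (Λ♭) `ThinLaunderingP` ∧ (Υ) `LateralUntwistP`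

### XIII.1  Why this cut
(G♭) asks for ONE object doing two jobs: a bijective bond isomorphism `Ψ₁ : S → LayeredHom L w₁` (GLOBAL COMBINATORICS: the chart carries `S`'s true
stacking word, letter for letter, at every height) that also REGISTERS the window (LOCAL METRIC: level `C♭·η` on `win R`).  The two jobs meet only in the
requirement that they index the good sites of the window by the same layers of the same chart (F5); everything else separates.  Producing a true-word
equilibrium chart whose layers through the window sit where `S`'s registered layers sit is the laundering problem (Λ♭) — it contains the tension retune
of (F1) (the given bond-isomorphic chart `LayeredHom L w` has the true word but arbitrary stress) and the garbage detection of (F2)/(F7) (the datum has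
the right stress and position but possibly the wrong letters above its reach), and it is the ONLY place where the multi-scale hypothesis and the thin
regime are used.  Making the registering map itself the bond isomorphism is the untwist (Υ): by (F5) the good-site same-layer clause turns the site-wise
discrepancy into a field of global symmetries of the chart, by (F6) that field is constant on good components after one re-anchoring, and the cost of the
exceptions is linear in the level — a statement about ONE equilibrium chart, ONE window and ONE level, with no access to other scales and no smallness
of `η·R²`: generic, like (P) of part TJ.  Alternatives rejected: «(Λ) without the same-layer clause ∧ (Υ) allowing vertical re-indexing» (bad cut by (F5));
«same-layer clause at every site» (bad cut: (Λ) would have to repair bad sites next to laterally twisted good components, i.e. do (Υ)'s work); a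
chart-to-chart proximity currency for (Λ) (the glue would need gradient-clause composition at unbounded radius); «index-offset currencies `Δw(m)`»
(meaningless: `LayeredHom` indexing is free, g36 §7) — hence layer-compatibility is stated through the tree's `layerOf`, never through indices of `w`.
| piece | type | tag | why strictly weaker than (G♭) | size |
|---|---|---|---|---|
| (Λ♭) `ThinLaunderingP` | EXISTENCE (true word at the datum's stress) + GARBAGE DETECTION (F7) + TRANSFER + vertical normalisation, regime `η·R² < c₀` | TRUE-expected ·
  ATTACKABLE · IDEA-NAMED (contraction `3a₁² = 3.5e-7`) · INSTRUMENTED | (G♭) ⇒ (Λ♭) PROVED; the registering map need not preserve a single bond, nor agree laterally with `Φ` | L |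
| (Υ) `LateralUntwistP` | RIGIDITY OF CONTACT-GRAPH LABELLINGS + linear cost accounting, one chart / window / level | TRUE-type · ATTACKABLE · M–L (F5, F6; trivial level `τ ≡ 12` at bad sites by (B4)) | no datum, no multi-scale hypothesis, no regime, no chart to produce | M–L |
Not decomposed (layer 3, memo §5): (Λ♭) ⟸ LETTER TRUTH (thin charts carry `S`'s letters in reach) ∧ SPACING LOCALITY of equilibrium chains (the
transport law `a₁`, typed on height slabs via `layerOf`, never via indices) ∧ TENSION RETUNE existence ∧ the regress glue (`n ≲ log(1/(η·R²))` thin steps).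
-/

/-! ### XIII.2  Same-layer re-anchoring is free for the environment clause (PROVED; the sound half of the untwist) -/

/-- in-plane lattice translations are global symmetries of a layered homogeneous configuration. [this file, g37] -/
theorem layeredHom_add_inplane (L : E3 →L[ℝ] E3) (w : ℤ → E3) (i j : ℤ) {q : E3} (hq : q ∈ LayeredHom L w) :
    q + L (((i : ℝ) • triangularVec₁ 1) + ((j : ℝ) • triangularVec₂ 1)) ∈ LayeredHom L w := by
  simp only [LayeredHom, Set.mem_setOf_eq] at hq ⊢
  obtain ⟨m, i', j', rfl⟩ := hq
  refine ⟨m, i' + i, j' + j, ?_⟩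
  simp only [Int.cast_add, add_smul, map_add]
  abel

/-- the inverse in-plane translation. [this file, g37] -/
theorem layeredHom_sub_inplane (L : E3 →L[ℝ] E3) (w : ℤ → E3) (i j : ℤ) {q : E3} (hq : q ∈ LayeredHom L w) :
    q - L (((i : ℝ) • triangularVec₁ 1) + ((j : ℝ) • triangularVec₂ 1)) ∈ LayeredHom L w := by
  simp only [LayeredHom, Set.mem_setOf_eq] at hq ⊢
  obtain ⟨m, i', j', rfl⟩ := hq
  refine ⟨m, i' - i, j' - j, ?_⟩
  simp only [Int.cast_sub, sub_smul, map_add, map_sub]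
  abel

/-- translating the model's base point by a two-sided symmetry `t` of the model preserves environment closeness. [this file, g37] -/
theorem envClose_translate_model {τ r : ℝ} {S H : Set E3} {x y t : E3} (hadd : ∀ q ∈ H, q + t ∈ H) (hsub : ∀ q ∈ H, q - t ∈ H)
    (h : EnvClose τ r S x H y) : EnvClose τ r S x H (y + t) := by
  refine ⟨fun p hp hpx => ?_, fun q hq hqy => ?_⟩
  · obtain ⟨q, hq, hd⟩ := h.1 p hp hpx
    exact ⟨q + t, hadd q hq, by rwa [add_sub_add_right_eq_sub]⟩
  · have e1 : dist (q - t) y = dist q (y + t) := by rw [dist_eq_norm, dist_eq_norm, sub_sub, add_comm t y]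
    obtain ⟨p, hp, hd⟩ := h.2 (q - t) (hsub q hq) (by rw [e1]; exact hqy)
    refine ⟨p, hp, ?_⟩
    have e2 : q - t - y = q - (y + t) := by rw [sub_sub, add_comm t y]
    rwa [e2] at hd

/-- two sites of the same layer differ by an in-plane lattice vector. [this file, g37] -/
theorem exists_inplane_of_layerOf {L : E3 →L[ℝ] E3} {w : ℤ → E3} {m : ℤ} {y y' : E3} (hy : y ∈ layerOf L w m) (hy' : y' ∈ layerOf L w m) :
    ∃ i j : ℤ, y' = y + L (((i : ℝ) • triangularVec₁ 1) + ((j : ℝ) • triangularVec₂ 1)) := by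
  simp only [layerOf, Set.mem_setOf_eq] at hy hy'
  obtain ⟨i, j, rfl⟩ := hy
  obtain ⟨i', j', rfl⟩ := hy'
  refine ⟨i' - i, j' - j, ?_⟩
  simp only [Int.cast_sub, sub_smul, map_add, map_sub]
  abel

/-- ★ **(F5, PROVED) the environment clause is invariant under same-layer re-anchoring**: if `y, y′` lie in the same layer of `LayeredHom L w`, the
`r`-environment of `x` in `S` is `τ`-close to that of `y` iff to that of `y′` (one direction stated; swap `y, y′` for the other) — the model's environments
at `y` and `y′` are translates of each other by a global symmetry.  This is why the same-layer clause makes the untwist (Υ) generic: after it, only the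
gradient clause and the level carry content. [this file, g37] -/
theorem envClose_of_sameLayer {τ r : ℝ} {S : Set E3} {x : E3} {L : E3 →L[ℝ] E3} {w : ℤ → E3} {m : ℤ} {y y' : E3}
    (hy : y ∈ layerOf L w m) (hy' : y' ∈ layerOf L w m) (h : EnvClose τ r S x (LayeredHom L w) y) :
    EnvClose τ r S x (LayeredHom L w) y' := by
  obtain ⟨i, j, rfl⟩ := exists_inplane_of_layerOf hy hy'
  exact envClose_translate_model (fun q hq => layeredHom_add_inplane L w i j hq) (fun q hq => layeredHom_sub_inplane L w i j hq) h

/-! ### XIII.3  The two pieces -/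

/-- ★★ **(Λ♭) «ThinLaunderingP aHi Λ θ s»** — LAUNDERING in the thin regime: under (G♭)'s hypotheses verbatim (door set, two-shell-good, `η ≤ η₁`,
`R ≥ R₁`, `η·R² < c₀` for a `c₀ > 0` of the prover's choosing, every scale `D ≥ R` registered at level `η` by equilibrium charts, the scale-`R` datum
`(L, w′, Ψ′, τ′)`, and a bond-isomorphic equilibrium chart `LayeredHom L w` with bijection `Ψ₀`), there is a TRUE-WORD equilibrium chart ON `L`:
offsets `w₁` with `IsEquilChart a s Λ L w₁`, a map `Ψ₁` REGISTERING `win R` into `LayeredHom L w₁` at level `C_Λ·η` (radius `4`, free position scale `ρ`),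
and a bijective bond isomorphism `Φ : S → LayeredHom L w₁` (so the chart carries `S`'s global stacking word) which is LAYER-COMPATIBLE with `Ψ₁` on the
GOOD sites of the window (`τ₁ x < 1/8` ⇒ `Ψ₁ x` and `Φ x` lie in a common `layerOf L w₁ m`; stated through `layerOf`, never through indices of `w₁`).
Mechanism (F7, every constant instrumented): LETTER TRUTH in reach from thinness (`c₀ ≤ 0.03`) · TENSION RETUNE (the true word continued at fixed frame `L`
to the datum's stress; tame existence, F1 of part TJ) · GARBAGE DETECTION by the cap triangle with the scale-`(R+8)` chart and ONE-STEP TRANSPORT of the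
power-law profile (`P(R) ≤ 6·η·(nK(win R) + nK(win (R+8))) + 3·a₁²·P(R+8)`, contraction `3·a₁² = 3.5e-7`, a-priori bound `P(D) ≤ c_f·D`, `n ≲
log(c_f/(η·R²))/15` thin steps) · TRANSFER `τ₁ ≤ τ′ + d` (`C_Λ ≤ 84` at `R = 10`, `26.3` as `R → ∞`, uniform in `η`) · VERTICAL NORMALISATION (`Ψ₁ :=`
the datum's map moved letter-by-letter onto the true chart; on each registration-consistent good cluster the layer assignment differs from `Φ`'s by a
constant, absorbed by composing with a vertical lattice translation of the chart on that cluster — clusters are `> 4` apart, so injectivity and the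
radius-`4` gradient clause survive).  Why it might fail: the polar sliver (`t < 4.12·√c₀` below the reach boundary) where the next chart's letter may
itself be wrong must carry `o(R)` cap weight at every step of the regress; the transport law must hold for the NONLINEAR chain at every stress of the
clean window (instrumented at zero stress only); the tension retune needs the own-word equilibrium family to reach the datum's stress inside the clean
window.  (G♭) ⇒ (Λ♭) PROVED (`thinLaunderingP_of_gradPinningThinP`).  EXISTENCE (tame) + GARBAGE DETECTION + ESTIMATE · TRUE-expected · ATTACKABLE ·
IDEA-NAMED · INSTRUMENTED (`layer_chain.py`: `h* = 0.7930`, `K₁ = 20.9`, `K_k ≈ −25.8·k⁻⁶`, `b₂ = 6.0e-4`, `κ₀ ≈ κ₁ ≈ 3.1e-5`, `κ_j ∼ j⁻⁴`, `u₁ = 3.3e-5`,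
`c_f = 6.2–6.8e-9`, `a₁ = 1.0–3.4e-4`).  Sources: [this tree: `GradPinningThinP`, `IsRegistered`, `IsEquilChart`, `IsBondIso`, `layerOf`,
`nash_force_balance`], [EMing2006 §2 (Cauchy–Born with inner relaxation)], [kruzik2019 p.55 Thm 1.1.12], [arXiv:1601.05968 (layer-chain energies of
stackings)], [kaxiras2003 §11.2]. [this file, g37] -/
def ThinLaunderingP (aHi Λ θ s : ℝ) : Prop :=
  ∃ c₀ : ℝ, 0 < c₀ ∧ ∀ δ : ℝ, 0 < δ → ∀ a : ℝ, 0 < a → ∃ Cl : ℝ, 1 ≤ Cl ∧ ∃ η₁ : ℝ, 0 < η₁ ∧ ∃ R₁ : ℝ, 0 < R₁ ∧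
    ∀ S : Set E3, IsDoorSetP aHi δ S → (∀ q ∈ S, IsTwoShellAffineGood θ S q) →
      ∀ η : ℝ, 0 < η → η ≤ η₁ → ∀ R : ℝ, R₁ ≤ R → η * R ^ 2 < c₀ →
        (∀ D : ℝ, R ≤ D → NearHomH1BDE a s Λ η 4 D S (atomsIn (μS S) 0 D)) →
          ∀ (L : E3 ≃L[ℝ] E3) (w' : ℤ → E3) (Ψ' : E3 → E3) (τ' : E3 → ℝ), IsEquilChart a s Λ L w' →
            IsRegistered η 4 R S (atomsIn (μS S) 0 R) (LayeredHom (L : E3 →L[ℝ] E3) w') Ψ' τ' →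
              ∀ (w : ℤ → E3) (Ψ₀ : E3 → E3), IsEquilChart a s Λ L w → Set.BijOn Ψ₀ S (LayeredHom (L : E3 →L[ℝ] E3) w) → IsBondIso S Ψ₀ →
                ∃ (w₁ : ℤ → E3) (Ψ₁ : E3 → E3) (ρ : ℝ) (τ₁ : E3 → ℝ) (Φ : E3 → E3), IsEquilChart a s Λ L w₁ ∧
                  IsRegistered (Cl * η) 4 ρ S (atomsIn (μS S) 0 R) (LayeredHom (L : E3 →L[ℝ] E3) w₁) Ψ₁ τ₁ ∧
                    Set.BijOn Φ S (LayeredHom (L : E3 →L[ℝ] E3) w₁) ∧ IsBondIso S Φ ∧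
                      ∀ x ∈ atomsIn (μS S) 0 R, τ₁ x < 1 / 8 →
                        ∃ m : ℤ, Ψ₁ x ∈ layerOf (L : E3 →L[ℝ] E3) w₁ m ∧ Φ x ∈ layerOf (L : E3 →L[ℝ] E3) w₁ m

/-- ★★ **(Υ) «LateralUntwistP aHi Λ θ s»** — THE LATERAL UNTWIST (generic; one chart, one window, one level): for every `δ, a` there are `C_U ≥ 1`, a
level ceiling `κ₁ > 0` and a floor `R₁` such that for every door set `S` (two-shell-good), every level `0 < κ ≤ κ₁`, every `R ≥ R₁`, every equilibrium
chart `LayeredHom L w`, every map `Ψ` registering `win R` into it at level `κ` (radius `4`, any position scale `ρ`, profile `τ`) and every bijective bond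
isomorphism `Φ : S → LayeredHom L w` that is LAYER-COMPATIBLE with `Ψ` on the GOOD sites of the window (`τ x < 1/8`), some bijective bond isomorphism
`Φ₁ : S → LayeredHom L w` registers `win R` at level `C_U·κ` (some position scale, some profile).  Intended `Φ₁ := σ⁻¹ ∘ Φ` with `σ` the layer-preserving
contact-graph automorphism of the chart matching `Φ` to `Ψ` at one good anchor (labelled first shell included); then (F5) on good sites the discrepancy
`Φ₁` vs `Ψ` is an in-plane lattice translation, constant on good components (F6), and the environment clause transfers with the same profile
(`envClose_of_sameLayer`); the gradient clause holds with profile `τ` inside good components, and with the trivial profile `12` (tear-freeness (B4),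
`bondIsoTearFreeP_one`) at bad sites (`τ x ≥ 1/8`: at most `64·κ·nK(win R)` of them) and at good sites within `4.6` of a bad one:
`Σ τ₁² ≤ Σ τ² + 144·(1 + 629)·64·κ·nK(win R)`, `C_U ≈ 1.2e7` (crude; linear in `κ·nK`, no regime); the position clause holds at a free scale.  Why it
might fail: two good components registered in orientations differing by a `120°` point symmetry of the chart (then no translation matches `Φ₁` to `Ψ` on
both) — excluded only by a John-type `L^∞` rigidity for clean boundaryless crystals (lattice-rotation oscillation `≤ C·θ` on balls with `C·θ < π/3`;
per-bond accumulation `2θ` per clean bond does not suffice beyond four bonds), whose discrete contact-graph version is not in the tree.  GENERIC RIGIDITY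
OF CONTACT-GRAPH LABELLINGS + LINEAR COST ACCOUNTING · TRUE-type · ATTACKABLE · M–L.  Sources: [this tree: `IsRegistered`, `IsBondIso`, `BondIsoTearFreeP`, `bondIsoTearFreeP_one`,
`fccTwoShellPattern`, `hcpTwoShellPattern`, `layerOf`, `envClose_of_sameLayer`], [ConwaySloane1999 Ch. 1 §1.3 (cuboctahedron / anticuboctahedron)],
[kruzik2019 p.55 Thm 1.1.12 (rigidity)], [Theil2006 §3]. [this file, g37] -/
def LateralUntwistP (aHi Λ θ s : ℝ) : Prop :=
  ∀ δ : ℝ, 0 < δ → ∀ a : ℝ, 0 < a → ∃ Cu : ℝ, 1 ≤ Cu ∧ ∃ κ₁ : ℝ, 0 < κ₁ ∧ ∃ R₁ : ℝ, 0 < R₁ ∧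
    ∀ S : Set E3, IsDoorSetP aHi δ S → (∀ q ∈ S, IsTwoShellAffineGood θ S q) →
      ∀ κ : ℝ, 0 < κ → κ ≤ κ₁ → ∀ R : ℝ, R₁ ≤ R →
        ∀ (L : E3 ≃L[ℝ] E3) (w : ℤ → E3) (Ψ : E3 → E3) (ρ : ℝ) (τ : E3 → ℝ) (Φ : E3 → E3), IsEquilChart a s Λ L w →
          IsRegistered κ 4 ρ S (atomsIn (μS S) 0 R) (LayeredHom (L : E3 →L[ℝ] E3) w) Ψ τ →
            Set.BijOn Φ S (LayeredHom (L : E3 →L[ℝ] E3) w) → IsBondIso S Φ →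
              (∀ x ∈ atomsIn (μS S) 0 R, τ x < 1 / 8 → ∃ m : ℤ, Ψ x ∈ layerOf (L : E3 →L[ℝ] E3) w m ∧ Φ x ∈ layerOf (L : E3 →L[ℝ] E3) w m) →
                ∃ (Φ₁ : E3 → E3) (ρ₁ : ℝ) (τ₁ : E3 → ℝ), Set.BijOn Φ₁ S (LayeredHom (L : E3 →L[ℝ] E3) w) ∧ IsBondIso S Φ₁ ∧
                  IsRegistered (Cu * κ) 4 ρ₁ S (atomsIn (μS S) 0 R) (LayeredHom (L : E3 →L[ℝ] E3) w) Φ₁ τ₁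

/-! ### XIII.4  Glue, projection, columns (PROVED) -/

/-- ★★★ **(G♭) ⟸ (Λ♭) ∧ (Υ) (PROVED)** — the node's glue: launder, then untwist at level `κ := C_Λ·η ≤ κ₁` (ceiling `min(η₁, κ₁/C_Λ)`); `C♭ := C_U·C_Λ`.
[this file, g37] -/
theorem gradPinningThinP_of_laundering_untwist {aHi Λ θ s : ℝ} (hl : ThinLaunderingP aHi Λ θ s) (hu : LateralUntwistP aHi Λ θ s) :
    GradPinningThinP aHi Λ θ s := by
  obtain ⟨c₀, hc₀, Hl⟩ := hl
  refine ⟨c₀, hc₀, fun δ hδ a ha => ?_⟩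
  obtain ⟨Cl, hCl, η₁, hη₁, R₁, hR₁, H₁⟩ := Hl δ hδ a ha
  obtain ⟨Cu, hCu, κ₁, hκ₁, R₂, hR₂, H₂⟩ := hu δ hδ a ha
  have hCl0 : 0 < Cl := one_pos.trans_le hCl
  refine ⟨Cu * Cl, one_le_mul_of_one_le_of_one_le hCu hCl, min η₁ (κ₁ / Cl), lt_min hη₁ (div_pos hκ₁ hCl0),
    max R₁ R₂, lt_max_of_lt_left hR₁, ?_⟩
  intro S hS hgood η hη hηle R hR hthin hms L w' Ψ' τ' hE' hreg' w Ψ₀ hEw hbij hiso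
  obtain ⟨w₁, Ψ₁, ρ, τ₁, Φ, hE₁, hr₁, hbΦ, hiΦ, hlay⟩ := H₁ S hS hgood η hη (hηle.trans (min_le_left _ _)) R
    ((le_max_left _ _).trans hR) hthin hms L w' Ψ' τ' hE' hreg' w Ψ₀ hEw hbij hiso
  have hκ : Cl * η ≤ κ₁ := by
    rw [mul_comm]
    exact (le_div_iff₀ hCl0).mp (hηle.trans (min_le_right _ _))
  obtain ⟨Φ₁, ρ₁, τ₂, hb₁, hi₁, hr₂⟩ := H₂ S hS hgood (Cl * η) (mul_pos hCl0 hη) hκ R ((le_max_right _ _).trans hR)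
    L w₁ Ψ₁ ρ τ₁ Φ hE₁ hr₁ hbΦ hiΦ hlay
  exact ⟨w₁, Φ₁, hE₁, hb₁, hi₁, ρ₁, τ₂, by rw [mul_assoc]; exact hr₂⟩

/-- ★ **(G♭) ⇒ (Λ♭) (PROVED)**: a registering bond isomorphism is its own laundered chart (`Ψ₁ := Φ := Ψ₁`, layer-compatibility reflexive) — the
laundering piece does not exceed the target. [this file, g37] -/
theorem thinLaunderingP_of_gradPinningThinP {aHi Λ θ s : ℝ} (h : GradPinningThinP aHi Λ θ s) : ThinLaunderingP aHi Λ θ s := by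
  obtain ⟨c₀, hc₀, H⟩ := h
  refine ⟨c₀, hc₀, fun δ hδ a ha => ?_⟩
  obtain ⟨Cb, hCb, η₁, hη₁, R₁, hR₁, H₁⟩ := H δ hδ a ha
  refine ⟨Cb, hCb, η₁, hη₁, R₁, hR₁, fun S hS hgood η hη hηle R hR hthin hms L w' Ψ' τ' hE' hreg' w Ψ₀ hEw hbij hiso => ?_⟩
  obtain ⟨w₁, Ψ₁, hE₁, hb₁, hi₁, ρ, τ₁, hr₁⟩ := H₁ S hS hgood η hη hηle R hR hthin hms L w' Ψ' τ' hE' hreg' w Ψ₀ hEw hbij hiso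
  refine ⟨w₁, Ψ₁, ρ, τ₁, Ψ₁, hE₁, hr₁, hb₁, hi₁, fun x hx _ => ?_⟩
  have hx' : Ψ₁ x ∈ LayeredHom (L : E3 →L[ℝ] E3) w₁ := hr₁.2.1 hx
  simp only [LayeredHom, Set.mem_setOf_eq] at hx'
  obtain ⟨m, i, j, hm⟩ := hx'
  have hl : Ψ₁ x ∈ layerOf (L : E3 →L[ℝ] E3) w₁ m := by
    simp only [layerOf, Set.mem_setOf_eq]
    exact ⟨i, j, hm⟩
  exact ⟨m, hl, hl⟩

/-- ★ **(B2♭) ⇒ (Λ♭) (PROVED)**: through (G♭). [this file, g37] -/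
theorem thinLaunderingP_of_bondIsoPinningP {aHi Λ θ s : ℝ} (h : BondIsoPinningP aHi Λ θ s) : ThinLaunderingP aHi Λ θ s :=
  thinLaunderingP_of_gradPinningThinP (thick_and_thin_of_bondIsoPinningP h).2

/-- ★★ **(B2♭) ⟸ (G♯) ∧ (Λ♭) ∧ (Υ) ∧ (P) (PROVED)** — the two lens-2 nodes composed. [this file, g37] -/
theorem bondIsoPinningP_of_pieces₂ {aHi Λ θ s : ℝ} (hT : GradPinningThickP aHi Λ θ s) (hl : ThinLaunderingP aHi Λ θ s)
    (hu : LateralUntwistP aHi Λ θ s) (hP : WindowPoincareP aHi) : BondIsoPinningP aHi Λ θ s :=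
  bondIsoPinningP_of_pieces hT (gradPinningThinP_of_laundering_untwist hl hu) hP

/-- ★ **(B2♭) ⟸ (G♯) ∧ (Λ♭) ∧ (Υ) at `aHi = 1` (PROVED)** — (P) discharged by `windowPoincareP_one` (hand-1 g17, part WindowPoincare). [this file, g37] -/
theorem bondIsoPinningP_of_thick_launder_untwist {Λ θ s : ℝ} (hT : GradPinningThickP 1 Λ θ s) (hl : ThinLaunderingP 1 Λ θ s)
    (hu : LateralUntwistP 1 Λ θ s) : BondIsoPinningP 1 Λ θ s :=
  bondIsoPinningP_of_thick_thin hT (gradPinningThinP_of_laundering_untwist hl hu)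

/-- ★★★ **COLUMN `_16XH14` — TWENTY opaque leaves** (`_16XH13` of part TK with (G♭) replaced by (Λ♭) and (Υ); (P) is the theorem
`windowPoincareP_one`): `LatticeLiouvilleCert → LayeredLiouvilleCert → R_G → X → Z_E → P → T → U♮ → B1 → G♯ → Λ♭ → Υ → A0♯⁺ → FF → E → A⁰ → D⁰ →
C♭ → R_W → PeriodicBulkGapDoor 2 → VisibleGap (1/50) ∧ PertRegime (1/50)` (all at `(aHi; Λ, θ, s) = (1; 2, 1/16, 1/50)`).  Open leaves on the (A0)-line:
(B1) [existence residual of record], (G♯) [tame existence + estimate], (Λ♭) [tame existence + garbage detection + estimate, thin], (Υ) [generic rigidity +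
linear accounting]. [this file, g37] -/
theorem gap_and_pert_1_50_of_certs_16XH14 (hL : LatticeLiouvilleCert) (hL' : LayeredLiouvilleCert)
    (hR : OscRigidityL2BDPG 1 2 (1 / 16) (1 / 16)) (hX : ExcessFlatnessControlP 1 2 (1 / 16) (1 / 16))
    (hE : ExcessChartLocalisationP 1 2 (1 / 16) (1 / 50)) (hP : RegistrationP 1 2 (1 / 16) (1 / 50))
    (hT : TailDominationCert) (hU : UniformTameStability (1 / 50) 2)
    (h1 : WordTransplantP 1 2 (1 / 16) (1 / 50)) (hGT : GradPinningThickP 1 2 (1 / 16) (1 / 50))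
    (hGl : ThinLaunderingP 1 2 (1 / 16) (1 / 50)) (hGu : LateralUntwistP 1 2 (1 / 16) (1 / 50))
    (hl : BondIsoLevelsP 1 2 (1 / 16) (1 / 50))
    (hF : TailForceSlavingP 1 2 (1 / 16) (1 / 50))
    (hE' : LipDualLinearisationP 1 2 (1 / 16) (1 / 50)) (hA : L2HarmonicApproxP 1 2 (1 / 16) (1 / 50))
    (hD : PositionDecayPL 1 2 (1 / 16) (1 / 50)) (hC : PositionCaccioppoliPG 1 2 (1 / 16) (1 / 50))
    (hW : WildFractionPG 1 2 (1 / 16) (1 / 50)) (hG : PeriodicBulkGapDoor 2) : VisibleGap (1 / 50) ∧ PertRegime (1 / 50) :=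
  gap_and_pert_1_50_of_certs_16XH13 hL hL' hR hX hE hP hT hU h1 hGT (gradPinningThinP_of_laundering_untwist hGl hGu) hl hF hE' hA hD hC hW hG

/-- ★ **COLUMN `_16XH14W`** — the same with (A1) «WildReRegistrationPG» in place of (R_W). [this file, g37] -/
theorem gap_and_pert_1_50_of_certs_16XH14W (hL : LatticeLiouvilleCert) (hL' : LayeredLiouvilleCert)
    (hR : OscRigidityL2BDPG 1 2 (1 / 16) (1 / 16)) (hX : ExcessFlatnessControlP 1 2 (1 / 16) (1 / 16))
    (hE : ExcessChartLocalisationP 1 2 (1 / 16) (1 / 50)) (hP : RegistrationP 1 2 (1 / 16) (1 / 50))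
    (hT : TailDominationCert) (hU : UniformTameStability (1 / 50) 2)
    (h1 : WordTransplantP 1 2 (1 / 16) (1 / 50)) (hGT : GradPinningThickP 1 2 (1 / 16) (1 / 50))
    (hGl : ThinLaunderingP 1 2 (1 / 16) (1 / 50)) (hGu : LateralUntwistP 1 2 (1 / 16) (1 / 50))
    (hl : BondIsoLevelsP 1 2 (1 / 16) (1 / 50))
    (hF : TailForceSlavingP 1 2 (1 / 16) (1 / 50))
    (hE' : LipDualLinearisationP 1 2 (1 / 16) (1 / 50)) (hA : L2HarmonicApproxP 1 2 (1 / 16) (1 / 50))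
    (hD : PositionDecayPL 1 2 (1 / 16) (1 / 50)) (hC : PositionCaccioppoliPG 1 2 (1 / 16) (1 / 50))
    (hw : WildReRegistrationPG 1 2 (1 / 16) (1 / 50)) (hG : PeriodicBulkGapDoor 2) : VisibleGap (1 / 50) ∧ PertRegime (1 / 50) :=
  gap_and_pert_1_50_of_certs_16XH13W hL hL' hR hX hE hP hT hU h1 hGT (gradPinningThinP_of_laundering_untwist hGl hGu) hl hF hE' hA hD hC hw hG

end Summit.AtomisticToContinuum.Crystallization.Theorems.ChartedZeroExcessLayeredLatticeLiouville

end
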